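import Literature.NumberTheory.Transcendental.PhilipponZeroEstimateStd
import HarnessLib

/-!
# The orbit count `card((Σ + G')/G')` in Philippon's zero estimate

Topic: `Literature/NumberTheory/Transcendental`. Support for the closing argument of Baker's
method on `M_κ` (plan item W4 of the unit
`provefact-Literature.NumberTheory.Transcendental.H-b596640137`). The factor
`GaGmE.Std.orbitCard K v S = card{[s·v] : 0 ≤ s ≤ S}` (classes modulo `exp⁻¹(G') = Lie G' + ker`)
of `PhilipponZeroEstimateStd.philippon1986_std` is computed when no small multiple of `v` meets
`exp⁻¹(G')`. PROVED:

* `ncard_range_nsmul_eq` — in an additive group, if `r • a ≠ 0` for `0 < r ≤ S` then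
  `#{s • a : s ≤ S} = S + 1`;
* `GaGmE.Std.orbitCard_eq` — if `r·v ∉ Lie G'_ℂ + ker` for `0 < r ≤ S` then
  `orbitCard K v S = S + 1`; `GaGmE.Std.orbitCard_le` — always `orbitCard K v S ≤ S + 1`, and
  `GaGmE.Std.one_le_orbitCard`.

## References

* P. Philippon, *Lemmes de zéros dans les groupes algébriques commutatifs*, Bull. SMF 114 (1986),
  Thm 2.1 (the factor `card((Σ + G')/G')`).
-/

noncomputable section

open scoped PeriodPair

namespace Literature.NumberTheory.Transcendental

/-- **Distinct multiples.** In an additive group, if `r • a ≠ 0` for all `0 < r ≤ S`, then the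
multiples `0, a, 2a, …, Sa` are pairwise distinct: `#{s • a : s ≤ S} = S + 1`. [folklore] -/
theorem ncard_range_nsmul_eq {A : Type*} [AddGroup A] (a : A) (S : ℕ)
    (h : ∀ r : ℕ, 0 < r → r ≤ S → r • a ≠ 0) :
    Set.ncard (Set.range fun s : Fin (S + 1) => (s : ℕ) • a) = S + 1 := by
  have hinj : Function.Injective fun s : Fin (S + 1) => (s : ℕ) • a := by
    intro s t hst
    simp only at hst
    by_contra hne
    rcases lt_or_gt_of_ne (fun h' => hne (Fin.ext h')) with hlt | hlt
    · have := h (t - s) (Nat.sub_pos_of_lt hlt) (by omega)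
      apply this
      rw [sub_nsmul _ hlt.le, ← hst, add_neg_cancel]
    · have := h (s - t) (Nat.sub_pos_of_lt hlt) (by omega)
      apply this
      rw [sub_nsmul _ hlt.le, hst, add_neg_cancel]
  rw [Set.ncard_range_of_injective hinj, Nat.card_eq_fintype_card, Fintype.card_fin]

namespace GaGmE

namespace Std

variable {β γ δ : Type} [Fintype β] [Fintype γ] [Fintype δ]
variable (L : PeriodPair) (κM : δ → γ → Kbar)

/-- `orbitCard ≤ S + 1`. [folklore] -/
theorem orbitCard_le (K : SubgroupDataC β γ δ κM) (v : β ⊕ (γ ⊕ δ) → ℂ) (S : ℕ) :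
    orbitCard L κM K v S ≤ S + 1 := by
  unfold orbitCard
  rw [← Set.image_univ]
  refine (Set.ncard_image_le (Set.finite_univ)).trans ?_
  rw [Set.ncard_univ, Nat.card_eq_fintype_card, Fintype.card_fin]

/-- `1 ≤ orbitCard`. [folklore] -/
theorem one_le_orbitCard (K : SubgroupDataC β γ δ κM) (v : β ⊕ (γ ⊕ δ) → ℂ) (S : ℕ) :
    1 ≤ orbitCard L κM K v S := by
  unfold orbitCard
  rw [Nat.one_le_iff_ne_zero, Ne, Set.ncard_eq_zero (Set.finite_range _)]
  exact Set.range_nonempty _ |>.ne_empty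

/-- **The orbit count without small multiples in `exp⁻¹(G')`.** If `r·v ∉ Lie G'_ℂ + ker` for all
`0 < r ≤ S` then `card((Σ + G')/G') = S + 1`. [cite: Philippon1986, Thm 2.1 (card((Σ+G')/G'))] -/
theorem orbitCard_eq (K : SubgroupDataC β γ δ κM) (v : β ⊕ (γ ⊕ δ) → ℂ) (S : ℕ)
    (h : ∀ r : ℕ, 0 < r → r ≤ S → (r : ℂ) • v ∉ preimageSubgroup L κM K) :
    orbitCard L κM K v S = S + 1 := by
  unfold orbitCard
  have e : (fun s : Fin (S + 1) =>
      (QuotientAddGroup.mk ((s : ℂ) • v) : (β ⊕ (γ ⊕ δ) → ℂ) ⧸ preimageSubgroup L κM K)) =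
      fun s : Fin (S + 1) => (s : ℕ) • (QuotientAddGroup.mk v : (β ⊕ (γ ⊕ δ) → ℂ) ⧸ preimageSubgroup L κM K) := by
    funext s
    rw [← QuotientAddGroup.mk_nsmul, ← Nat.cast_smul_eq_nsmul ℂ]
  rw [e]
  refine ncard_range_nsmul_eq _ S fun r hr hrS hzero => h r hr hrS ?_
  rw [← QuotientAddGroup.mk_nsmul, ← Nat.cast_smul_eq_nsmul ℂ, QuotientAddGroup.eq_zero_iff] at hzero
  exact hzero

end Std

end GaGmE

end Literature.NumberTheory.Transcendental

end
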